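import Mathlib
import Literature.MathematicalPhysics.QuantumFieldTheory.Balaban1983to89.B1
import Literature.MathematicalPhysics.QuantumFieldTheory.Balaban1983to89.B2

/-!
# `Balaban1983to89.B1LowerBound` — B1's Theorem (1.14) p. 606 and the statements of its proof, §3 pp. 612–625:
the small-field characteristic functions (3.1)–(3.2)/(3.27)–(3.28), the induction hypothesis (3.26)–(3.32),
Propositions 3.1 (p. 620) and 3.2 (p. 622), the cumulant expansion (3.59), and — KERNEL-PROVED — the logarithmic
inequality behind the determinant bounds (3.47) (p. 620), (3.69) (p. 625) and B2 (2.103), (3.20)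

HONEST FRAMING (lit-balaban, verbatim): statement-level skeleton of published theorems with citation tags; proofs
where landed; nothing here is a claim about the Yang–Mills mass gap.

B1 = T. Bałaban, *(Higgs)₂,₃ quantum fields in a finite volume. I. A lower bound*, Commun. Math. Phys. **85**,
603–626 (1982) [Balaban1982Higgs1] (held: `paper:balaban1982-cmp85-higgs23-i`; journal page = PDF page + 602);
quotations from the ×2 renders `…/pages/1982-cmp85-higgs23-I/…-p004, p011, p015, p018, p020, p021, p023-x2.png`
(pp. 606, 613, 617, 620, 622, 623, 625).  Unit `lit-balaban-r14` (READER/TYPER of B1–B2); SKELETON rows B1-Thm,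
B1-3.01 … B1-3.69 of `run/shared/lean/pub/lit-balaban/SKELETON.md`.

RELATION TO THE TREE: `…Balaban1983to89.B1` (b2b-pv07) types Props. 2.1–2.3 and the operator algebra of §3
((3.15), (3.16), (3.44), (3.45)); `…B1RT` (this unit) the transformations of §2; `…B2` supplies `B2.pFn` = the
function p(ε) = b₀(1 + log ε⁻¹)^p of (3.1) and `B2.Run.StopsAt` = the stopping rule "L^Kε ≤ ε₀, L^{K+1}ε > ε₀"
(B1 p. 624 = B2 p. 582).  Nothing of those modules is restated; this module is imported by nothing yet.

THE SOURCE TEXT, verbatim.  p. 606 [PDF 4]: *"Now the fundamental result of this paper can be formulated.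
**Theorem.** For the dimensions d = 2, 3 there exist the constants E₋, E₊ independent of ε, T_ε and such that
exp(−E₋|T_ε|) ≤ Z^ε ≤ exp(E₊|T_ε|). (1.14)  … The second remark concerns the estimates of a generating functional.
Using the same method of proof we can extend the Theorem in several ways. One of the simplest extensions is
exp(−E₋(‖J‖, ‖f‖)|T_ε|) ≤ Z^ε(J,f) = ∫dA∫dφ exp(−S^ε(A,φ) + ⟨J,A⟩ + ⟨f,φ⟩) ≤ exp(E₊(‖J‖, ‖f‖)|T_ε|), (1.15) where the
"sources" J, f are arbitrary, ‖·‖ is some norm, e.g. we can take the norm of L^∞, and the functions E_±(·,·) are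
continuous and independent of ε, T_ε."*  (|T_ε| = Σ_{x∈T_ε} ε^d, (1.21) p. 607; Z^ε = ∫dA∫dφ exp(−S^ε(A,φ)) (1.10)
p. 605 with the Feynman-gauge action (1.11) including the counterterms δm², E = E₀ + E₁ (1.12)–(1.13).)  B1 proves
the lower bound (§3, pp. 612–625), B2 = [Balaban1982Higgs2] the upper bound (its Theorem (1.3) p. 556 is this
Theorem restated), with "some technical estimates" deferred to B3 = [Balaban1983Higgs3].
p. 613 [PDF 11]: *"In the first step we introduce the characteristic functions χ₀(A) = Π_{x∈T_ε}
χ({|A(x)| ≤ ε^{−(d−2)/2}p(ε)}) χ({|(Δ^εA)(x)| ≤ ε^{−(d+2)/2}p(ε)}), p(ε) = b₀(1 + log ε^{−1})^p, (3.1)  χ₀(φ) = Π_{x∈T_ε}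
χ({|φ(x)| ≤ ε^{−(d−2)/2}p(ε)}) χ({|(Δ^ε_Aφ)(x)| ≤ ε^{−(d+2)/2}p(ε)}). (3.2) … and the following inequality holds
Z^ε ≥ ∫dB∫dψ χ₁(B)χ₁(ψ)T^ε_{a,L}[T^ε_{a,L,A}[χ₀(A)χ₀(φ)exp(−S^ε)]]. (3.6)"*
p. 617 [PDF 15]: *"We assume that after k renormalization transformations we get an action S^{(k),L^kε}(A,φ) for the
fields A, φ on L^kε-lattice T^{(k)}_{L^kε}. For this action the following fundamental inequality holds
Z^ε ≥ ∫dA∫dφ χ_k(A)χ_k(φ) exp(−S^{(k),L^kε}(A,φ) + Σ_{j=0}^{k−1} O(1)(L^jε)^{κ₀}|T_ε|), (3.26) where χ_k(A) = Π_{x∈T_ε}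
χ({|A^{(k),ε}(x)| ≤ (L^kε)^{−(d−2)/2}p(L^kε)})·χ({|(Δ^εA^{(k),ε})(x)| ≤ (L^kε)^{−(d+2)/2}p(L^kε)}), (3.27)
[χ_k(φ) likewise with φ^{(k),ε}, Δ^ε_{A^{(k),ε}} (3.28)], A^{(k),ε} = a_k(L^kε)^{−2}G^ε_kQ^*_kA, φ^{(k),ε} =
a_k(L^kε)^{−2}G^ε_k(A^{(k),ε})Q^*_k(A^{(k),ε})φ. (3.29) The action has the form: S^{(k),L^kε}(A,φ) = −log Z_k −
log Z_k(A^{(k),ε}) + ½⟨A,Δ^{(k),L^kε}A⟩ + ½⟨φ,Δ^{(k),L^kε}(A^{(k),ε})φ⟩ − 𝒫^{(k),L^kε}(A^{(k),ε},φ) + E₀, (3.30)"* with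
the Gaussian normalization factors Z_k, Z_k(A^{(k),ε}) of (3.31)–(3.32).
p. 620 [PDF 18]: *"Obviously the operators standing in the above determinants are positive and symmetric. Thus the
inequality log(1 + λ) ≤ λ − λ²/2 + λ³/3 + … + (−1)^{n−1}λⁿ/n holding for n odd and λ real, λ > −1, implies the
following inequality for the second determinant on the right side of (3.46): [det(I − G_k(B^{(k+1)})^{1/2}V_k
G_k(B^{(k+1)})^{1/2})]^{−1/2} ≥ exp Σ_{j=1}^n (1/2j) Tr(G_k(B^{(k+1)})V_k)^j. (3.47) We take n odd and n ≥ n̄. …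
**Proposition 3.1.** The sum of R-terms of the previously described expansion of the action S^{(k)} is of the order
O(1)(L^kε)^κ|T^{(k)}_1| for some κ > d. Also of the same order is the sum of terms, for which the sum of the powers of
the factors L^kε occurring at the vertices is greater than d. In these estimates O(1) is independent of k, it
depends only on the coupling constants and the number n̄.  This theorem will be obtained as a corollary of an
analysis of the perturbation expansions and its renormalization."* (R-terms, ibid.: the terms carrying a Taylor
remainder factor R_{n̄+1}(ηqe(L^kε)A′^{(k)}(Γ^{(k)}_{y,x})) or R_{n̄+1}(ηqe(L^kε)A′^{(k)}_b) of (3.14).)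
p. 622 [PDF 20]: *"**Proposition 3.2.** The function V^{(k)}(B^{(k+1)},ψ,A′^{(k)},φ′) has the form V^{(k)}(…) =
Σ_{n,m=0}^{n(n̄)} Σ_{x₁,…,x_n,y₁,…,y_m∈T^{(k)}_1} Σ_{j₁,…,j_n=1}^N Σ_{μ₁,…,μ_m=1}^d v^{(k)}_{j₁,…,j_n;μ₁,…,μ_m}(B^{(k+1)},ψ;
x₁,…,x_n,y₁,…,y_m) φ′_{j₁}(x₁)…φ′_{j_n}(x_n)·A′_{μ₁}(y₁)…A′_{μ_m}(y_m), (3.57) and the coefficients in the above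
representation satisfy the inequalities |v^{(k)}_{j₁,…,j_n;μ₁,…,μ_m}(B^{(k+1)},ψ; x₁,…,x_n,y₁,…,y_m)| ≤ O(1)(L^kε)^{κ₀}
exp(−δ₀d(x₁,…,x_n,y₁,…,y_m)) (3.58) for some independent of k positive constants κ₀, δ₀, and O(1), where
d(x₁,…,x_n,y₁,…,y_m) denotes a length of the shortest graph connecting the points x₁,…,x_n,y₁,…,y_m."*  p. 623:
*"A proof of this theorem will be given together with the proofs of the other properties of the perturbation
expansions. … Using the lemma [of [2] = Benfatto et al., CMP 59 (1978), p. 152] we get (3.56) = ⟨χ(A′)χ(φ′)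
exp(V^{(k)})⟩ = exp[Σ_{n=1}^{n̄} (1/n!)⟨(V^{(k)})ⁿ⟩^T + O(1)(L^kε)^κ|T^{(k)}_1|], κ > d. (3.59) It is worth mentioning
that κ₀ in (3.58) can be taken as κ₀ = ½ − β, where β is an arbitrarily small positive number, so for the expansion
(3.59) to hold it is sufficient to take n̄ ≥ 6."*  p. 625 [PDF 23]: *"Z^ε ≥ Z_KZ_K(0)exp(−E₀ + O(1)|T_ε|). (3.68) It
is easily seen that Z_KZ_K(0) is almost equal exp(E₀), more exactly we have Z_KZ_K(0)exp(−E₀) =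
[det(I + a_K(L^Kε)^{d−2}P_KG^ε)]^{−1/2}·[det(I + a_K(L^Kε)^{d−2}P_KG^ε(0))]^{−1/2}exp(O(1)|T_ε|) ≥
exp[−½a_K(L^Kε)^{d−2}(Tr P_KG^ε + Tr P_KG^ε(0)) + O(1)|T_ε|] = exp(O(1)|T_ε|), (3.69) and we obtain finally the
required lower bound."*

WHAT IS TYPED.  (i) The Theorem and (1.15) over an abstract carrier `CutoffFamily` (one instance = one lattice
spacing ε with its torus: fields `vol` ↤ |T_ε|, `Z` ↤ Z^ε), with its two halves named (`LowerBoundPrinted` = B1's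
result, `UpperBoundPrinted` = B2's); (ii) the restrictions (3.1)/(3.2)/(3.27)/(3.28) as the predicate the
characteristic functions indicate (`SmallFieldAt`, with `B2.pFn` for p), and (3.29) as the linear expression it is
(`bgField`); (iii) the induction hypothesis (3.26) over a carrier naming Z^ε, the k-th restricted integral and the
error exponent κ₀ (`IndHyp326`); (iv) Props. 3.1, 3.2 and the expansion (3.59) over carriers whose fields NAME the
printed quantities (`Prop31Printed`, `Prop32Printed`, `Cumulant359`) — their proofs are B3's ("will be obtained as a
corollary of an analysis of the perturbation expansions"); (v) KERNEL-PROVED: the real inequality *"log(1 + λ) ≤ λ −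
λ²/2 + … + (−1)^{n−1}λⁿ/n holding for n odd and λ real, λ > −1"* (`log_one_add_le_logTaylor`, by the sign of the
derivative x^n/(1 + x) of the difference), the scalar engine of (3.47), (3.69) and of B2 (2.103), (3.20); the
matrix form (3.47) is TYPED (`Ineq347`, proof = spectral theorem + the scalar inequality, deferred).  NOT typed:
the step-by-step manipulations (3.7)–(3.25), (3.33)–(3.46), (3.48)–(3.56), (3.60)–(3.67) (proof-internal displays;
the operator identities among them are in `…B1`), and the perturbative objects 𝒫^{(k)}, E′, V^{(k)} beyond the
shape Prop. 3.2 prints.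
-/

open scoped BigOperators
open Finset

namespace Literature.MathematicalPhysics.QuantumFieldTheory.Balaban1983to89.B1LowerBound

/-! ## The Theorem (1.14) p. 606 and its extension (1.15) -/

/-- Abstract carrier for the Theorem: a family of lattice cutoffs.  One INSTANCE `i` = one lattice spacing ε
(of the admissible form ε⁻¹L_μ = L^KMℒ_μ, (1.2) p. 604) with its torus T_ε; `eps i` ↤ ε, `vol i` ↤ |T_ε| =
Σ_{x∈T_ε} ε^d (1.21), `Z i` ↤ the partition function Z^ε = ∫dA∫dφ exp(−S^ε(A,φ)) (1.10) with the Feynman-gauge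
action (1.11) (counterterms δm², E = E₀ + E₁ of (1.12)–(1.13) included; d = 2, 3, μ₀² > 0, λ > 0, m² > 0 fixed for
the family). [cite: Balaban1982Higgs1, (1.10)–(1.14) pp.605–606] -/
structure CutoffFamily (I : Type) where
  eps : I → ℝ
  vol : I → ℝ
  Z : I → ℝ

variable {I : Type}

/-- The lower bound of (1.14) with constant E₋: exp(−E₋|T_ε|) ≤ Z^ε for every cutoff — the half proved in B1
(§3, concluded by (3.68)–(3.69) p. 625). [cite: Balaban1982Higgs1, Theorem (1.14) p.606] -/
def LowerBoundWith (F : CutoffFamily I) (Em : ℝ) : Prop :=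
  ∀ i : I, Real.exp (-(Em * F.vol i)) ≤ F.Z i

/-- The upper bound of (1.14) with constant E₊: Z^ε ≤ exp(E₊|T_ε|) for every cutoff — the half proved in B2
([Balaban1982Higgs2], (2.117) + §3). [cite: Balaban1982Higgs1, Theorem (1.14) p.606] -/
def UpperBoundWith (F : CutoffFamily I) (Ep : ℝ) : Prop :=
  ∀ i : I, F.Z i ≤ Real.exp (Ep * F.vol i)

/-- B1's result: *"there exist the constant E₋ independent of ε, T_ε"* with the lower bound.
[cite: Balaban1982Higgs1, Theorem (1.14) p.606] -/
def LowerBoundPrinted (F : CutoffFamily I) : Prop := ∃ Em : ℝ, LowerBoundWith F Em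

/-- B2's result (its Theorem (1.3) p. 556 restates (1.14); B2 proves the second inequality).
[cite: Balaban1982Higgs1, Theorem (1.14) p.606] -/
def UpperBoundPrinted (F : CutoffFamily I) : Prop := ∃ Ep : ℝ, UpperBoundWith F Ep

/-- **Theorem** (p. 606 [PDF 4], verbatim): *"For the dimensions d = 2, 3 there exist the constants E₋, E₊
independent of ε, T_ε and such that exp(−E₋|T_ε|) ≤ Z^ε ≤ exp(E₊|T_ε|). (1.14)"*  (ultraviolet stability of the
lattice (Higgs)₂,₃ = abelian-Higgs/Proca model in a finite volume). [cite: Balaban1982Higgs1, Theorem (1.14) p.606] -/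
def ThmPrinted (F : CutoffFamily I) : Prop :=
  ∃ Em Ep : ℝ, ∀ i : I, Real.exp (-(Em * F.vol i)) ≤ F.Z i ∧ F.Z i ≤ Real.exp (Ep * F.vol i)

/-- The Theorem is exactly the conjunction of its two printed halves (B1's lower bound, B2's upper bound). KERNEL.
[cite: Balaban1982Higgs1, Theorem (1.14) p.606] -/
theorem thmPrinted_iff (F : CutoffFamily I) : ThmPrinted F ↔ LowerBoundPrinted F ∧ UpperBoundPrinted F := by
  constructor
  · rintro ⟨Em, Ep, h⟩
    exact ⟨⟨Em, fun i => (h i).1⟩, ⟨Ep, fun i => (h i).2⟩⟩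
  · rintro ⟨⟨Em, hm⟩, ⟨Ep, hp⟩⟩
    exact ⟨Em, Ep, fun i => ⟨hm i, hp i⟩⟩

/-- Carrier for the extension (1.15): cutoffs with sources.  `Src i` ↤ the pairs (J, f) of sources on T_ε,
`nJ i s`, `nf i s` ↤ ‖J‖, ‖f‖ (*"some norm, e.g. … of L^∞"*), `ZS i s` ↤ Z^ε(J,f) = ∫dA∫dφ exp(−S^ε(A,φ) + ⟨J,A⟩ +
⟨f,φ⟩). [cite: Balaban1982Higgs1, (1.15) p.606] -/
structure SourceFamily (I : Type) extends CutoffFamily I where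
  Src : I → Type
  nJ : (i : I) → Src i → ℝ
  nf : (i : I) → Src i → ℝ
  ZS : (i : I) → Src i → ℝ

/-- **(1.15)** p. 606 (remark, verbatim above): bounds exp(∓E_∓(‖J‖,‖f‖)|T_ε|) for the generating functional
with *"the functions E_±(·,·) … continuous and independent of ε, T_ε"*.  Printed as an extension obtainable *"using
the same method of proof"*; no proof is printed. [cite: Balaban1982Higgs1, (1.15) p.606] -/
def Ext115Printed (F : SourceFamily I) : Prop :=
  ∃ Em Ep : ℝ → ℝ → ℝ, Continuous (Function.uncurry Em) ∧ Continuous (Function.uncurry Ep) ∧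
    ∀ (i : I) (s : F.Src i),
      Real.exp (-(Em (F.nJ i s) (F.nf i s) * F.vol i)) ≤ F.ZS i s ∧
        F.ZS i s ≤ Real.exp (Ep (F.nJ i s) (F.nf i s) * F.vol i)

/-! ## §3 pp. 613, 617: the restrictions on the fields and the induction hypothesis -/

/-- The restriction the characteristic functions (3.1)/(3.2) (ε-lattice, first step) and (3.27)/(3.28) (after k
steps, ℓ = L^kε) indicate, at one point x: *"|A(x)| ≤ ℓ^{−(d−2)/2}p(ℓ)"* and *"|(Δ A)(x)| ≤ ℓ^{−(d+2)/2}p(ℓ)"* —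
DICTIONARY `absF` ↤ |A^{(k),ε}(x)| (resp. |φ^{(k),ε}(x)|), `absLap` ↤ |(Δ^εA^{(k),ε})(x)| (resp. the covariant
Laplacian |(Δ^ε_{A^{(k),ε}}φ^{(k),ε})(x)|), `pℓ` ↤ p(ℓ) = `B2.pFn b₀ p ℓ`. [cite: Balaban1982Higgs1, (3.1)–(3.2) p.613, (3.27)–(3.28) p.617] -/
def SmallFieldAt (d : ℕ) (ℓ pℓ absF absLap : ℝ) : Prop :=
  absF ≤ ℓ ^ (-(((d : ℝ) - 2) / 2)) * pℓ ∧ absLap ≤ ℓ ^ (-(((d : ℝ) + 2) / 2)) * pℓ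

/-- χ_k(A) = 1 (resp. χ_k(φ) = 1), (3.27)/(3.28) p. 617 (k = 0: (3.1)/(3.2) p. 613): the restriction holds at EVERY
point of T_ε, with p(L^kε) = b₀(1 + log(L^kε)⁻¹)^p (`B2.pFn`).  `X` ↤ T_ε. [cite: Balaban1982Higgs1, (3.27)–(3.28) p.617] -/
def ChiK (d : ℕ) (b₀ p ℓ : ℝ) {X : Type} (absF absLap : X → ℝ) : Prop :=
  ∀ x : X, SmallFieldAt d ℓ (B2.pFn b₀ p ℓ) (absF x) (absLap x)

/-- The restriction is monotone in p(ℓ): a larger threshold is a weaker restriction (used implicitly throughout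
§3, e.g. (3.13), (3.21), (3.54), where thresholds are compared). [cite: Balaban1982Higgs1, (3.13) p.614] -/
theorem SmallFieldAt.mono {d : ℕ} {ℓ p₁ p₂ absF absLap : ℝ} (hℓ : 0 ≤ ℓ) (hp : p₁ ≤ p₂)
    (h : SmallFieldAt d ℓ p₁ absF absLap) : SmallFieldAt d ℓ p₂ absF absLap :=
  ⟨h.1.trans (mul_le_mul_of_nonneg_left hp (Real.rpow_nonneg hℓ _)),
    h.2.trans (mul_le_mul_of_nonneg_left hp (Real.rpow_nonneg hℓ _))⟩

/-- **(3.29)** p. 617: the background ("minimizing") configurations A^{(k),ε} = a_k(L^kε)^{−2}G^ε_kQ^*_kA,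
φ^{(k),ε} = a_k(L^kε)^{−2}G^ε_k(A^{(k),ε})Q^*_k(A^{(k),ε})φ — the common linear shape `a_kℓ^{−2}·G(Q^*ψ)`; DICTIONARY
`G` ↤ G^ε_k (resp. G^ε_k(A^{(k),ε})), `Qs` ↤ Q^*_k (resp. Q^*_k(A^{(k),ε})), `ak` ↤ a_k, `ℓ` ↤ L^kε (cf. (3.3) p. 613 for
k = 1; B2 (2.44), (2.56) are the localized variants). [cite: Balaban1982Higgs1, (3.29) p.617] -/
noncomputable def bgField {M M' : Type} [AddCommGroup M] [Module ℝ M] [AddCommGroup M'] [Module ℝ M']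
    (ak ℓ : ℝ) (G : M →ₗ[ℝ] M) (Qs : M' →ₗ[ℝ] M) (ψ : M') : M :=
  (ak * (ℓ ^ 2)⁻¹) • G (Qs ψ)

/-- (3.29) is linear in the block field. [cite: Balaban1982Higgs1, (3.29) p.617] -/
theorem bgField_add {M M' : Type} [AddCommGroup M] [Module ℝ M] [AddCommGroup M'] [Module ℝ M'] (ak ℓ : ℝ)
    (G : M →ₗ[ℝ] M) (Qs : M' →ₗ[ℝ] M) (ψ ψ' : M') :
    bgField ak ℓ G Qs (ψ + ψ') = bgField ak ℓ G Qs ψ + bgField ak ℓ G Qs ψ' := by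
  simp [bgField, map_add, smul_add]

/-- Carrier for the induction hypothesis (3.26): one RUN of the procedure at lattice spacing `eps` with `K` steps
(stopping rule `B2.Run.StopsAt`: L^Kε ≤ ε₀ < L^{K+1}ε, p. 624), `vol` ↤ |T_ε|, `Z` ↤ Z^ε, and `intK k` ↤ the k-th
restricted integral ∫dA∫dφ χ_k(A)χ_k(φ)exp(−S^{(k),L^kε}(A,φ)) of (3.26) (the action (3.30) with its factors
(3.31)–(3.32)); `L` the block size. [cite: Balaban1982Higgs1, (3.26)–(3.32) p.617] -/
structure Run326 where
  eps : ℝ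
  L : ℝ
  K : ℕ
  vol : ℝ
  Z : ℝ
  intK : ℕ → ℝ

/-- **(3.26)** p. 617, the *"fundamental inequality"* of the induction hypothesis, for all k ≤ K with ONE constant:
*"Z^ε ≥ ∫dA∫dφ χ_k(A)χ_k(φ)exp(−S^{(k),L^kε}(A,φ) + Σ_{j=0}^{k−1}O(1)(L^jε)^{κ₀}|T_ε|)"* — read (as a lower bound
must be) with the O(1) terms bounded below by −C: Z^ε ≥ intK(k)·exp(−C Σ_{j<k}(L^jε)^{κ₀}|T_ε|), C and κ₀ > 0
independent of k and ε. [cite: Balaban1982Higgs1, (3.26) p.617] -/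
def IndHyp326 {J : Type} (fam : J → Run326) : Prop :=
  ∃ C κ₀ : ℝ, 0 < κ₀ ∧ ∀ (j : J) (k : ℕ), k ≤ (fam j).K →
    (fam j).intK k * Real.exp (-(C * (∑ i ∈ range k, ((fam j).L ^ i * (fam j).eps) ^ κ₀) * (fam j).vol))
      ≤ (fam j).Z

/-! ## Proposition 3.1 p. 620, Proposition 3.2 p. 622, the cumulant expansion (3.59) p. 623 -/

/-- Carrier for Prop. 3.1: for every step k of a run, `Rsum k` ↤ the sum of the R-terms of the expansion of the
action S^{(k)} (terms carrying a Taylor-remainder factor R_{n̄+1}(·) of (3.14)), `highSum k` ↤ the sum of the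
terms whose total power of L^kε at the vertices exceeds d, `volK k` ↤ |T^{(k)}_1| (number of points of the unit
lattice after k steps), `ell k` ↤ L^kε; `d` the dimension. [cite: Balaban1982Higgs1, Prop. 3.1 p.620] -/
structure P31Setting where
  d : ℕ
  Rsum : ℕ → ℝ
  highSum : ℕ → ℝ
  volK : ℕ → ℝ
  ell : ℕ → ℝ

/-- **Proposition 3.1** (p. 620 [PDF 18], verbatim in the module docstring): both sums are *"of the order
O(1)(L^kε)^κ|T^{(k)}_1| for some κ > d … O(1) is independent of k, it depends only on the coupling constants and
the number n̄"* — one κ > d and one constant for the whole family of runs and steps.  Proof deferred in print to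
B3 ("a corollary of an analysis of the perturbation expansions and its renormalization"). [cite: Balaban1982Higgs1, Prop. 3.1 p.620] -/
def Prop31Printed {J : Type} (fam : J → P31Setting) : Prop :=
  ∃ κ C : ℝ, (∀ j, ((fam j).d : ℝ) < κ) ∧ ∀ (j : J) (k : ℕ),
    |(fam j).Rsum k| ≤ C * (fam j).ell k ^ κ * (fam j).volK k ∧
      |(fam j).highSum k| ≤ C * (fam j).ell k ^ κ * (fam j).volK k

/-- Carrier for Prop. 3.2: for every step k, `Mono k` ↤ the index set of the monomials of (3.57) (n, m ≤ n(n̄);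
points x₁…x_n, y₁…y_m ∈ T^{(k)}_1; indices j₁…j_n ≤ N, μ₁…μ_m ≤ d), `coefAbs k τ` ↤ |v^{(k)}_{j;μ}(B^{(k+1)},ψ; x,y)|,
`treeLen k τ` ↤ d(x₁,…,x_n,y₁,…,y_m) = *"a length of the shortest graph connecting the points"*, `ell k` ↤ L^kε.
[cite: Balaban1982Higgs1, Prop. 3.2 (3.57)–(3.58) p.622] -/
structure P32Setting where
  Mono : ℕ → Type
  coefAbs : (k : ℕ) → Mono k → ℝ
  treeLen : (k : ℕ) → Mono k → ℝ
  ell : ℕ → ℝ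

/-- **Proposition 3.2** (p. 622 [PDF 20], verbatim in the module docstring): the representation (3.57) (*"obvious"*,
p. 623) with coefficients bounded by (3.58) |v^{(k)}| ≤ O(1)(L^kε)^{κ₀}exp(−δ₀ d(x₁,…,y_m)) *"for some independent of
k positive constants κ₀, δ₀, and O(1)"* (p. 623: κ₀ = ½ − β admissible).  Proof deferred in print to B3.
[cite: Balaban1982Higgs1, Prop. 3.2 (3.58) p.622] -/
def Prop32Printed {J : Type} (fam : J → P32Setting) : Prop :=
  ∃ κ₀ δ₀ C : ℝ, 0 < κ₀ ∧ 0 < δ₀ ∧ 0 < C ∧ ∀ (j : J) (k : ℕ) (τ : (fam j).Mono k),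
    (fam j).coefAbs k τ ≤ C * (fam j).ell k ^ κ₀ * Real.exp (-(δ₀ * (fam j).treeLen k τ))

/-- Carrier for (3.59): for every step k, `lhs k` ↤ ⟨χ(A′)χ(φ′)exp(V^{(k)})⟩ (the Gaussian expectation (3.56) w.r.t.
dμ_{C^{(k)}}(A′)dμ_{C^{(k)}(B^{(k+1)})}(φ′)), `trunc k n` ↤ the truncated moment ⟨(V^{(k)})ⁿ⟩^T, `nbar` ↤ n̄, `volK k` ↤
|T^{(k)}_1|, `ell k` ↤ L^kε, `d` the dimension. [cite: Balaban1982Higgs1, (3.56), (3.59) pp.622–623] -/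
structure C359Setting where
  d : ℕ
  nbar : ℕ
  lhs : ℕ → ℝ
  trunc : ℕ → ℕ → ℝ
  volK : ℕ → ℝ
  ell : ℕ → ℝ

/-- **(3.59)** p. 623 (from *"the lemma [2]"* = Benfatto, Cassandro, Gallavotti, Nicolò, Olivieri, Presutti,
Scacciatelli, CMP 59 (1978), lemma p. 152, applied under Props. 2.2, 2.3, 3.2): *"(3.56) = ⟨χ(A′)χ(φ′)exp(V^{(k)})⟩
= exp[Σ_{n=1}^{n̄}(1/n!)⟨(V^{(k)})ⁿ⟩^T + O(1)(L^kε)^κ|T^{(k)}_1|], κ > d"* — typed with the O(1)-term as an explicit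
remainder of absolute value ≤ C(L^kε)^κ|T^{(k)}_1|, one κ > d and C for all k. [cite: Balaban1982Higgs1, (3.59) p.623] -/
def Cumulant359 {J : Type} (fam : J → C359Setting) : Prop :=
  ∃ κ C : ℝ, (∀ j, ((fam j).d : ℝ) < κ) ∧ ∀ (j : J) (k : ℕ), ∃ R : ℝ,
    |R| ≤ C * (fam j).ell k ^ κ * (fam j).volK k ∧
      (fam j).lhs k = Real.exp ((∑ n ∈ Icc 1 (fam j).nbar, (fam j).trunc k n / (n.factorial : ℝ)) + R)

/-! ## The logarithmic inequality of p. 620 (engine of (3.47), (3.69), B2 (2.103), (3.20)) — KERNEL-PROVED -/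

/-- The odd Taylor polynomial of log(1 + x): `logTaylor n x = Σ_{j=1}^{n} (−1)^{j−1}x^j/j` (indexed j − 1 ∈ range n).
[cite: Balaban1982Higgs1, (3.47) p.620] -/
noncomputable def logTaylor (n : ℕ) (x : ℝ) : ℝ :=
  ∑ j ∈ range n, (-1) ^ j * x ^ (j + 1) / (j + 1)

/-- Unfolding lemma (definitional). [cite: Balaban1982Higgs1, (3.47) p.620] -/
theorem logTaylor_eq (n : ℕ) (x : ℝ) : logTaylor n x = ∑ j ∈ range n, (-1) ^ j * x ^ (j + 1) / (j + 1) := rfl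

/-- `logTaylor n 0 = 0`. [cite: Balaban1982Higgs1, (3.47) p.620] -/
theorem logTaylor_zero (n : ℕ) : logTaylor n 0 = 0 := by
  simp [logTaylor]

/-- n = 1: the polynomial is λ itself (the case used in (3.69) p. 625: det(I + K)^{−1/2} ≥ exp(−½Tr K)).
[cite: Balaban1982Higgs1, (3.69) p.625] -/
theorem logTaylor_one (x : ℝ) : logTaylor 1 x = x := by
  simp [logTaylor]

/-- The derivative of the Taylor polynomial is the geometric sum Σ_{j<n}(−x)^j. [cite: Balaban1982Higgs1, (3.47) p.620] -/
theorem hasDerivAt_logTaylor (n : ℕ) (x : ℝ) :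
    HasDerivAt (logTaylor n) (∑ j ∈ range n, (-x) ^ j) x := by
  have h : ∀ j ∈ range n,
      HasDerivAt (fun y : ℝ => (-1 : ℝ) ^ j * y ^ (j + 1) / (j + 1)) ((-x) ^ j) x := by
    intro j _
    have h1 := ((hasDerivAt_pow (j + 1) x).const_mul ((-1 : ℝ) ^ j)).div_const ((j : ℝ) + 1)
    have e : (-1 : ℝ) ^ j * (((j + 1 : ℕ) : ℝ) * x ^ (j + 1 - 1)) / ((j : ℝ) + 1) = (-x) ^ j := by
      rw [neg_pow x j, Nat.add_sub_cancel]
      push_cast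
      field_simp
    rw [e] at h1
    exact h1
  exact HasDerivAt.fun_sum h

/-- For n odd and x ≠ −1 the geometric sum minus 1/(1 + x) is xⁿ/(1 + x): the derivative of
`logTaylor n x − log(1 + x)`. [cite: Balaban1982Higgs1, (3.47) p.620] -/
theorem geom_sub_inv_eq {n : ℕ} (hn : Odd n) {x : ℝ} (hx : x ≠ -1) :
    (∑ j ∈ range n, (-x) ^ j) - (1 + x)⁻¹ = x ^ n / (1 + x) := by
  have hx1 : (-x) ≠ 1 := fun h => hx (by linarith)
  have h1x : 1 + x ≠ 0 := fun h => hx (by linarith)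
  rw [geom_sum_eq hx1, hn.neg_pow]
  have e1 : (-x ^ n - 1) / (-x - 1) = (x ^ n + 1) / (1 + x) := by
    rw [show -x ^ n - 1 = -(x ^ n + 1) by ring, show -x - 1 = -(1 + x) by ring, neg_div_neg_eq]
  rw [e1, inv_eq_one_div, ← sub_div]
  congr 1
  ring

/-- **The inequality of p. 620** (verbatim): *"log(1 + λ) ≤ λ − λ²/2 + λ³/3 + … + (−1)^{n−1}λⁿ/n holding for n odd and
λ real, λ > −1"*.  KERNEL: the difference f(λ) = P_n(λ) − log(1 + λ) vanishes at 0 and has derivative λⁿ/(1 + λ),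
which is ≤ 0 on (−1, 0) and ≥ 0 on (0, ∞) for n odd, so f ≥ f(0) = 0 on both sides (monotonicity from the sign of
the derivative).  It is the scalar engine of the determinant bounds (3.47) p. 620, (3.69) p. 625, and of B2 =
[Balaban1982Higgs2] (2.103) p. 578, (3.20) p. 587. [cite: Balaban1982Higgs1, (3.47) p.620] -/
theorem log_one_add_le_logTaylor {n : ℕ} (hn : Odd n) {x : ℝ} (hx : -1 < x) :
    Real.log (1 + x) ≤ logTaylor n x := by
  -- the difference and its derivative
  set f : ℝ → ℝ := fun y => logTaylor n y - Real.log (1 + y) with hf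
  have hderiv : ∀ y : ℝ, -1 < y → HasDerivAt f (y ^ n / (1 + y)) y := by
    intro y hy
    have hy0 : 1 + y ≠ 0 := by linarith
    have hlog : HasDerivAt (fun y : ℝ => Real.log (1 + y)) (1 + y)⁻¹ y := by
      have h := (Real.hasDerivAt_log hy0).comp y ((hasDerivAt_id y).const_add 1)
      simpa [Function.comp_def] using h
    have h := (hasDerivAt_logTaylor n y).sub hlog
    rw [geom_sub_inv_eq hn (by linarith : y ≠ -1)] at h
    exact h
  have hcont : ∀ y : ℝ, -1 < y → ContinuousAt f y := fun y hy => (hderiv y hy).continuousAt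
  have hf0 : f 0 = 0 := by simp [hf, logTaylor_zero]
  have hdiffOn : ∀ s : Set ℝ, (∀ y ∈ s, -1 < y) → DifferentiableOn ℝ f s := fun s hs y hy =>
    (hderiv y (hs y hy)).differentiableAt.differentiableWithinAt
  have hcontOn : ∀ s : Set ℝ, (∀ y ∈ s, -1 < y) → ContinuousOn f s := fun s hs y hy =>
    (hcont y (hs y hy)).continuousWithinAt
  -- f ≥ 0 according to the sign of x
  suffices h : 0 ≤ f x by
    simpa [hf] using h
  rcases le_or_gt 0 x with hx0 | hx0
  · -- on [0, ∞) the derivative is ≥ 0, f is monotone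
    have hmono : MonotoneOn f (Set.Ici 0) := by
      refine monotoneOn_of_deriv_nonneg (convex_Ici 0) (hcontOn _ fun y hy => ?_) ?_ ?_
      · exact lt_of_lt_of_le (by norm_num) (Set.mem_Ici.1 hy)
      · rw [interior_Ici]
        exact hdiffOn _ fun y hy => lt_trans (by norm_num) (Set.mem_Ioi.1 hy)
      · intro y hy
        rw [interior_Ici] at hy
        have hy' : 0 < y := hy
        rw [(hderiv y (by linarith)).deriv]
        positivity
    have := hmono (Set.mem_Ici.2 le_rfl) (Set.mem_Ici.2 hx0) hx0
    rwa [hf0] at this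
  · -- on (−1, 0] the derivative is ≤ 0, f is antitone
    have hanti : AntitoneOn f (Set.Ioc (-1) 0) := by
      refine antitoneOn_of_deriv_nonpos (convex_Ioc (-1) 0) (hcontOn _ fun y hy => hy.1) ?_ ?_
      · rw [interior_Ioc]
        exact hdiffOn _ fun y hy => hy.1
      · intro y hy
        rw [interior_Ioc] at hy
        rw [(hderiv y hy.1).deriv]
        have hyn : y ^ n ≤ 0 := (Odd.pow_nonpos_iff hn).2 hy.2.le
        have hy1 : 0 < 1 + y := by linarith [hy.1]
        exact div_nonpos_of_nonpos_of_nonneg hyn hy1.le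
    have := hanti ⟨hx, hx0.le⟩ ⟨by norm_num, le_rfl⟩ hx0.le
    rwa [hf0] at this

/-- The case n = 1: log(1 + λ) ≤ λ for λ > −1 — the form used in (3.69) p. 625 and, eigenvalue-wise, giving
det(I + K)^{−1/2} ≥ exp(−½Tr K) for K ≥ 0. [cite: Balaban1982Higgs1, (3.69) p.625] -/
theorem log_one_add_le_self {x : ℝ} (hx : -1 < x) : Real.log (1 + x) ≤ x := by
  simpa [logTaylor_one] using log_one_add_le_logTaylor odd_one hx

/-- **(3.47)** p. 620 TYPED in matrix form: for a real symmetric K (↤ G_k(B^{(k+1)})^{1/2}V_kG_k(B^{(k+1)})^{1/2})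
with I − K positive definite (*"the operators standing in the above determinants are positive and symmetric"*) and
n odd, [det(I − K)]^{−1/2} ≥ exp Σ_{j=1}^n (1/2j)Tr K^j (Tr(G_kV_k)^j = Tr K^j by cyclicity).  The predicate; its
proof (the scalar inequality `log_one_add_le_logTaylor` at each eigenvalue λ = −k_i > −1 of −K, summed — spectral
theorem) is DEFERRED. [cite: Balaban1982Higgs1, (3.47) p.620] -/
def Ineq347 {m : Type} [Fintype m] [DecidableEq m] (K : Matrix m m ℝ) (n : ℕ) : Prop :=
  Real.exp (∑ j ∈ range n, (1 / (2 * ((j : ℝ) + 1))) * (K ^ (j + 1)).trace) ≤ (1 - K).det ^ (-(1 / 2 : ℝ))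

/-- (3.47) for 1 × 1 matrices IS the scalar inequality: for k < 1 and n odd, exp(Σ_{j=1}^n k^j/(2j)) ≤
(1 − k)^{−1/2}.  KERNEL (sanity instance of the typed matrix statement, from `log_one_add_le_logTaylor` at λ = −k).
[cite: Balaban1982Higgs1, (3.47) p.620] -/
theorem ineq347_scalar {n : ℕ} (hn : Odd n) {k : ℝ} (hk : k < 1) :
    Real.exp (∑ j ∈ range n, (1 / (2 * ((j : ℝ) + 1))) * k ^ (j + 1)) ≤ (1 - k) ^ (-(1 / 2 : ℝ)) := by
  have h1k : 0 < 1 - k := by linarith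
  have hlog := log_one_add_le_logTaylor hn (by linarith : -1 < -k)
  -- (1 - k)^(-1/2) = exp(-(1/2) log(1 - k))
  rw [Real.rpow_def_of_pos h1k, Real.exp_le_exp]
  have e : ∑ j ∈ range n, (1 / (2 * ((j : ℝ) + 1))) * k ^ (j + 1) = -(1 / 2) * logTaylor n (-k) := by
    rw [logTaylor_eq, mul_sum]
    refine sum_congr rfl fun j _ => ?_
    rcases Nat.even_or_odd j with he | ho
    · rw [he.neg_one_pow, Odd.neg_pow he.add_one]
      field_simp
    · rw [ho.neg_one_pow, Even.neg_pow ho.add_one]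
      field_simp
  rw [show (1 : ℝ) + -k = 1 - k by ring] at hlog
  rw [e, mul_comm (Real.log (1 - k))]
  exact mul_le_mul_of_nonpos_left hlog (by norm_num)

end Literature.MathematicalPhysics.QuantumFieldTheory.Balaban1983to89.B1LowerBound
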